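import Mathlib

/-!
# STUB-IDEAS k3 (gen 19) — sketch for `stub_heegnerIndexLowerAtTwo`
# (crux `PrintCf2.SplitBadTwoLowerHalfOfFacts`, stmt-BirchSwinnertonDyer-27851, route PrintCf2)

TECHNIQUE (family 3 → decomposition): «R112 EXECUTED FROM THE TREE'S CONSTRUCTIVE WITNESSES ⟹ THE
ALGEBRAIC DIGIT VANISHES: `e_C + e_δ ≡ 0` on all six dyadic keys ⟹ the stub decomposes as
LOWER ⟸ ALG (theorem-grade, digit-free: `n′ = v₂#Ш[2^∞] + v₂Tam − 2·v₂#tors + 2ℓ`) ∧ CONT (T1⁻) ∧ S2′∃ ∧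
INT (`e_A ≥ −1`, ONE key-free inequality)», with the glue, the anchor law and the sharpness example
kernel-checked below (Mathlib only; `lean check` target rc 0, NO `sorry`).

HONEST FRAMING. Nothing here proves the stub, the crux, or BSD. BSD is NOT proved by any of this. The
objects are ℤ-shadows of 2-adic valuations («digits»); every table is copied VERBATIM from a proof
witness in the tree (file / theorem named in each docstring), and the theorems below are arithmetic
consequences of those tables. Section C (typed over the tree's own declarations) lives in the companion
file `STUB_IDEAS_stub_heegnerIndexLowerAtTwo_3_g19_typed.lean` when it elaborates on the farm; this
file is self-contained.

KEYS. `[d]₂ = (d % 2, (d / (2 − d % 2)) % 8)` for squarefree `d ≢ 1 (mod 4)`; the six admissible keys are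
`(1,3), (1,7) ∣ (0,1), (0,3), (0,5), (0,7)` (odd depth class ∣ even depth class).
-/

set_option linter.dupNamespace false
set_option autoImplicit false

namespace Summit.BirchSwinnertonDyer.BirchSwinnertonDyer.Cruxes.SplitBadTwoLowerHalfOfFacts.StubIdeasK3G19

/-! ## §A  R112 executed: the composite S3c digit `e_C` and the S3d digit `e_δ`, verbatim witnesses -/

/-- (F1) Kummer factor digit `e₁ = 2 − t([d]₂) = −[d ≡ 3 (8)]` — witness of
`RestrictedSelmerPair.hF1_holds` (`Theorems/PrintCf2SplitBadTwoF1Holds.lean`: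
`refine ⟨fun i j ↦ if i = 1 ∧ j = 3 then -1 else 0, ?_⟩`). -/
def e1 : ℤ → ℤ → ℤ := fun i j ↦ if i = 1 ∧ j = 3 then -1 else 0

/-- (F3)/(PI) local point-image digit `e₃ ≡ 0` — witness of `hPI_holds`
(`Theorems/PrintCf2SplitBadTwoLocalPointImageAtV.lean` l. 210: `refine ⟨fun _ _ ↦ 0, ?_⟩`), passed unchanged
through `hcounts_of_pointIndex_of_pinning_of_finiteSha` and `hF3_of_levelCounts` to `hF3_holds`. -/
def e3 : ℤ → ℤ → ℤ := fun _ _ ↦ 0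

/-- (R-BV) bottom-value digit `e_K = e₁ + e₃` — witness of `rBV_of_three_factor_values`
(`Theorems/PrintCf2SplitBadTwoRestrictedSelmerBottomValueOfFactors.lean` l. 124:
`refine ⟨fun a b ↦ e₁ a b + e₃ a b, ?_⟩`), reached from `restrictedControl_two_holds` via
`CMPrimes.rBV_of_factor_values_of_locCyclic` → `rBV_of_factor_values_of_sel`. -/
def eK : ℤ → ℤ → ℤ := fun a b ↦ e1 a b + e3 a b

/-- (R-DY) dyadic local-kernel digit `e_v̄ = v₂ #LK_v̄` — witness of
`exists_ev_padicValNat_natCard_localKer_vbar_of_kerC3`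
(`Theorems/PrintCf2SplitBadTwoLocalControlKernelDyadicTable.lean` l. 16), fed by `dyadicResidual_holds`. -/
def ev : ℤ → ℤ → ℤ := fun i j ↦ if (i = 1 ∧ j = 7) ∨ (i = 0 ∧ (j = 1 ∨ j = 3 ∨ j = 5)) then 1 else 0

/-- (R-SURJ″) exact-cokernel digit `e_s ≡ −1` — witness of `rSurj''_of_locSurj_of_finite`
(`Theorems/PrintCf2SplitBadTwoRestrictedSelmerCokernelOfLocSurjFinite.lean`: `refine ⟨fun _ _ ↦ -1, ?_⟩`). -/
def es : ℤ → ℤ → ℤ := fun _ _ ↦ -1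

/-- (R-KER) kernel digit `e_k ≡ 0` — witness of `RestrictedSelmerPair.kerResidual_holds`
(`Theorems/PrintCf2SplitBadTwoRestrictedControlKernelResidual.lean`: `refine ⟨fun _ _ ↦ 0, ?_⟩`). -/
def ek : ℤ → ℤ → ℤ := fun _ _ ↦ 0

/-- (R-TOP′) top/coinvariant digit `e_Γ ≡ 0` — witness of `rTop'_of_locSurj_of_finite`
(`Theorems/PrintCf2SplitBadTwoRestrictedTopOfLocSurj.lean`: `refine ⟨fun _ _ ↦ 0, ?_⟩`). -/
def eΓ : ℤ → ℤ → ℤ := fun _ _ ↦ 0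

/-- THE S3c DIGIT `e_C := e_K + e_v̄ + e_s − e_k − e_Γ` — the lambda of cut 10
`RestrictedSelmerPair.restrictedControl_two_of_locSurj_bv`
(`Theorems/PrintCf2SplitBadTwoRestrictedControlOfLocSurjBV.lean` l. 125:
`refine ⟨fun a b ↦ eK a b + ev a b + es a b - ek a b - eΓ a b, ?_⟩`), which is the witness behind the S3c
theorem of record `SelmerLocImage.restrictedControl_two_holds` (cuts 11–14 pass the existential through:
`exact restrictedControl_two_of_…`). -/
def eC : ℤ → ℤ → ℤ := fun a b ↦ eK a b + ev a b + es a b - ek a b - eΓ a b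

/-- THE S3d DIGIT `e_δ = E = (2, 0 ∣ 0, 0, 0, 1)` — witness of `StrictDefect.stub_strictDefectAtVbar_two`
(p698800; `Theorems/PrintCf2SplitBadTwoRankOneOfFactsStrictDefectAtVbarTwo.lean` l. 16:
`eδ k₁ k₂ := if k₁ = 1 ∧ k₂ = 3 then 2 else if k₁ = 0 ∧ k₂ = 7 then 1 else 0`). -/
def eδ : ℤ → ℤ → ℤ := fun k₁ k₂ ↦ if k₁ = 1 ∧ k₂ = 3 then 2 else if k₁ = 0 ∧ k₂ = 7 then 1 else 0

/-- The formal-torsion bit `θ = [d ≡ 3 (8)]` (`t = v₂ #W(ℚ₂)[2^∞]-side = 2 + θ`, B20 addendum). -/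
def θ : ℤ → ℤ → ℤ := fun i j ↦ if i = 1 ∧ j = 3 then 1 else 0

/-- The six admissible dyadic keys. -/
def Admissible (i j : ℤ) : Prop := (i = 1 ∧ (j = 3 ∨ j = 7)) ∨ (i = 0 ∧ (j = 1 ∨ j = 3 ∨ j = 5 ∨ j = 7))

instance (i j : ℤ) : Decidable (Admissible i j) := by unfold Admissible; infer_instance

/-- R112, column form: `e_C = e_v̄ − 1 − θ` identically (the memo's `t`-column is `e₁ = 2 − t = −θ`,
its `τ_v`-column is `e₃ ≡ 0`, and `e_s, e_k, e_Γ` are the constants `−1, 0, 0`). -/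
theorem eC_eq (i j : ℤ) : eC i j = ev i j - 1 - θ i j := by
  simp only [eC, eK, e1, e3, es, ek, eΓ, θ]
  split_ifs <;> ring

/-- R112 EXECUTED — the table `e_C = (−2, 0 ∣ 0, 0, 0, −1)` on `((1,3),(1,7) ∣ (0,1),(0,3),(0,5),(0,7))`. -/
theorem eC_table :
    eC 1 3 = -2 ∧ eC 1 7 = 0 ∧ eC 0 1 = 0 ∧ eC 0 3 = 0 ∧ eC 0 5 = 0 ∧ eC 0 7 = -1 := by decide

/-- Row 48's fork is decided: `Δ_C := e_C(1,7) − e_C(1,3) = 2` (k3-g17 predicted 2; the plan expected 1). -/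
theorem deltaC_eq_two : eC 1 7 - eC 1 3 = 2 := by decide

/-- THE VANISHING. On every admissible key the algebraic composite digit is zero: `e_C + e_δ = 0`. -/
theorem vanishing {i j : ℤ} (h : Admissible i j) : eC i j + eδ i j = 0 := by
  rcases h with ⟨rfl, rfl | rfl⟩ | ⟨rfl, rfl | rfl | rfl | rfl⟩ <;> decide

/-- … equivalently (with B20's addendum `LK + E = 1 + θ`) — the two audit identities are the same fact. -/
theorem b20_addendum {i j : ℤ} (h : Admissible i j) : ev i j + eδ i j = 1 + θ i j := by
  rcases h with ⟨rfl, rfl | rfl⟩ | ⟨rfl, rfl | rfl | rfl | rfl⟩ <;> decide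

/-- The identity is a SIX-KEY fact, not an identity of class functions on `ℤ × ℤ`: off the admissible keys
it fails (so the explicit-witness corollaries H1a–H1c must carry admissibility, which every frame has). -/
theorem not_vanishing_off_keys : eC 0 0 + eδ 0 0 ≠ 0 := by decide

/-- Squarefree integers are not divisible by `4` (the tree's `h4` step, Mathlib-only). -/
theorem not_four_dvd_of_squarefree {d : ℤ} (hsq : Squarefree d) : ¬ (4 : ℤ) ∣ d := by
  rintro ⟨k, hk⟩
  have h2 : IsUnit (2 : ℤ) := hsq 2 ⟨k, by rw [hk]; ring⟩
  rw [Int.isUnit_iff] at h2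
  omega

/-- Every class member's key is admissible (squarefree, `d % 4 ≠ 1`). -/
theorem admissible_key_of_member {d : ℤ} (hsq : Squarefree d) (hd4 : d % 4 ≠ 1) :
    Admissible (d % 2) ((d / (2 - d % 2)) % 8) := by
  have h4 := not_four_dvd_of_squarefree hsq
  unfold Admissible
  rcases Int.emod_two_eq_zero_or_one d with h | h <;> rw [h] <;> norm_num <;> omega

/-- MEMBER FORM of the vanishing (the shape the explicit-witness corollary H1 consumes). -/
theorem vanishing_member {d : ℤ} (hsq : Squarefree d) (hd4 : d % 4 ≠ 1) :
    eC (d % 2) ((d / (2 - d % 2)) % 8) + eδ (d % 2) ((d / (2 - d % 2)) % 8) = 0 :=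
  vanishing (admissible_key_of_member hsq hd4)

/-! ## §B  The decomposition glue, the anchor law, sharpness

Digits of ONE member `W` of key `k` with frame `(P, c₀, ℓ)`:
`A = v₂ #Ш_an(W)` (`padicValRat 2 q`), `B = v₂ #Ш(W)[2^∞]`, `g = v₂ Tam(W) − 2·v₂ #W(ℚ)_tors + 2ℓ`,
`m` = S2′'s exponent (`‖val‖ = 2^{−m/2}`, `m = 2(A + g) + e_A(k)`: `RubinValueFormulaAtTwoV11`),
`n` = S3c's char valuation (`n = B + g + e_C(k)`: `restrictedControl_two_holds`),
`n′` = the GV datum's valuation (`n′ = n + e_δ(k)`: `strictDefectAtVbarTwo_holds`),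
CONT = T1⁻ containment read at the out-of-range point: `m + 2·junk₀(W) ≤ 2n′` (`junk₀ ≥ 0`; LINE⁻ books
`e_M := −2·junk₀ ≤ 0`). LOWER is `A ≤ B`. -/

/-- GLUE (decomposition of the stub below the K-side bridge): ALG ∧ VANISHING ∧ CONT ∧ S2′ ∧ INT ⟹ LOWER.
INT is the single key-free inequality `−1 ≤ e_A`. -/
theorem lower_of_chain {A B g m n n' eA eCk eδk junk : ℤ}
    (hS2 : m = 2 * (A + g) + eA)            -- S2′∃ (open, (a))
    (hS3c : n = B + g + eCk)                 -- S3c (theorem)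
    (hS3d : n' = n + eδk)                    -- S3d (theorem)
    (hvan : eCk + eδk = 0)                   -- §A `vanishing`
    (hCONT : m + 2 * junk ≤ 2 * n')          -- T1⁻ containment (open, (c))
    (hjunk : 0 ≤ junk)
    (hINT : -1 ≤ eA) :                       -- INT (the ONE analytic digit condition)
    A ≤ B := by
  omega

/-- What the chain yields for a general digit: `A ≤ B − junk − ⌈e_A/2⌉`; INT is exactly what makes it LOWER. -/
theorem chain_bound {A B g m n n' eA eCk eδk junk : ℤ}
    (hS2 : m = 2 * (A + g) + eA) (hS3c : n = B + g + eCk) (hS3d : n' = n + eδk) (hvan : eCk + eδk = 0)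
    (hCONT : m + 2 * junk ≤ 2 * n') : 2 * A + eA + 2 * junk ≤ 2 * B := by
  omega

/-- SHARPNESS of INT: with `e_A = −2` every hypothesis of the chain can hold at a junk-free member with
`A = B + 1`, i.e. LOWER is lost by exactly one. (So `e_A ≥ −1` is the chain's precise analytic target.) -/
theorem int_sharp : ∃ A B g m n n' eA eCk eδk junk : ℤ,
    m = 2 * (A + g) + eA ∧ n = B + g + eCk ∧ n' = n + eδk ∧ eCk + eδk = 0 ∧ m + 2 * junk ≤ 2 * n' ∧
    0 ≤ junk ∧ eA = -2 ∧ ¬ A ≤ B :=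
  ⟨1, 0, 0, 0, -2, 0, -2, -2, 2, 0, by norm_num⟩

/-- ANCHOR LAW. At a member where BSD₂ is KNOWN (`A₀ = B₀`; conductor `784`, `3136`: Miller 2011 Thm 7.1,
tree `SmallConductorRankLeOneBSDTriple`), CONT ∧ S2′ ∧ ALG force `e_A(k₀) ≤ −2·junk₀(W₀) ≤ 0`. -/
theorem anchor_law {A₀ B₀ g m n n' eA eCk eδk junk : ℤ}
    (hBSD : A₀ = B₀) (hS2 : m = 2 * (A₀ + g) + eA) (hS3c : n = B₀ + g + eCk) (hS3d : n' = n + eδk)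
    (hvan : eCk + eδk = 0) (hCONT : m + 2 * junk ≤ 2 * n') : eA ≤ -2 * junk := by
  omega

/-- … hence on an ANCHORED key the chain can close LOWER only with `e_A ∈ {0, −1}` AND a junk-free anchor. -/
theorem anchored_key_closable {A₀ B₀ g m n n' eA eCk eδk junk : ℤ}
    (hBSD : A₀ = B₀) (hS2 : m = 2 * (A₀ + g) + eA) (hS3c : n = B₀ + g + eCk) (hS3d : n' = n + eδk)
    (hvan : eCk + eδk = 0) (hCONT : m + 2 * junk ≤ 2 * n') (hjunk : 0 ≤ junk) (hINT : -1 ≤ eA) :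
    (eA = 0 ∨ eA = -1) ∧ junk = 0 := by
  omega

/-- PREDICTION FOR R136 in k2-g18's depth-affine form `e_A(n_v) = (2κ′ − γ₀) + (1 − γ₁)·n_v`, the two depth
classes `n_v = 2` (odd keys; anchored at (1,7), `d = −1`, `N = 784`) and `n_v = 3` (even keys; anchored at
(0,7), `d = −2`, `N = 3136`): both anchored values in `{0, −1}` pin `γ₁ ∈ {0, 1, 2}` and leave three
candidate pairs — a two-line check on the explicit ledger, and any other outcome REFUTES (CONT as typed) ∨
(S2′-v11's normalisation) at a BSD₂-known curve. -/
theorem k2g18_pinned {c γ₁ : ℤ}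
    (h2 : c + (1 - γ₁) * 2 = 0 ∨ c + (1 - γ₁) * 2 = -1)
    (h3 : c + (1 - γ₁) * 3 = 0 ∨ c + (1 - γ₁) * 3 = -1) :
    (γ₁ = 1 ∧ c = 0) ∨ (γ₁ = 1 ∧ c = -1) ∨ (γ₁ = 2 ∧ c = 2) ∨ (γ₁ = 0 ∧ c = -3) := by
  omega

/-- UNDER EA-n (row 48: `e_A` depends on the key only through the depth class) the two anchored keys
bound `e_A ≤ 0` on ALL SIX keys; INT then reads `e_A(odd class), e_A(even class) ∈ {0, −1}` — and the
cross-key columns of R104 / the per-key tables of T3.5, H6, R107 are all identically ZERO. -/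
theorem six_keys_from_two_anchors {eOdd eEven : ℤ} (eA : ℤ → ℤ → ℤ)
    (hEAn : ∀ i j, Admissible i j → eA i j = if i = 1 then eOdd else eEven)
    (h17 : eA 1 7 ≤ 0) (h07 : eA 0 7 ≤ 0) :
    ∀ i j, Admissible i j → eA i j ≤ 0 := by
  intro i j hij
  have h17' := hEAn 1 7 (by decide)
  have h07' := hEAn 0 7 (by decide)
  rw [hEAn i j hij]
  rcases hij with ⟨rfl, -⟩ | ⟨rfl, -⟩
  · simp only [if_true] at h17' ⊢; omega
  · simp only [zero_ne_one, if_false] at h07' ⊢; omega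

/-- THE RETIRED BUDGET, for the record: the per-key threshold `E_A(k) := 2(e_C + e_δ)(k) − 1` of the
one-sided plans (T3.5 / H6 / R107 shape `e_A⁻(k) ≥ E_A(k)`) is the CONSTANT `−1`. -/
theorem threshold_constant {i j : ℤ} (h : Admissible i j) : 2 * (eC i j + eδ i j) - 1 = -1 := by
  rw [vanishing h]; rfl


/-! ## §C′  The real-valued glue of the decomposition D1 ∧ D2 ∧ D3 ⟹ LOWER (norm sandwich)

D2 (CONT⁻, p694174's conclusion shape, `zpow`): `(2:ℝ) ^ (-(n' : ℤ)) ≤ ‖val‖`; D3 (S2′-L₀): `‖val‖ ≤ 2 ^ (1/2 − x)` with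
`x = A + g`; D1 (ALG₀): `n' = B + g`. Integrality absorbs the half. -/

theorem lower_of_norm_sandwich {A B g n' x : ℤ} {r : ℝ}
    (hcont : (2 : ℝ) ^ (-(n' : ℝ)) ≤ r) (hval : r ≤ (2 : ℝ) ^ ((1 : ℝ) / 2 - (x : ℝ)))
    (halg : n' = B + g) (hx : x = A + g) : A ≤ B := by
  have h := le_trans hcont hval
  have h' : (-(n' : ℝ)) ≤ (1 : ℝ) / 2 - (x : ℝ) :=
    (Real.rpow_le_rpow_left_iff (by norm_num : (1 : ℝ) < 2)).mp h
  have hlt : ((x : ℤ) : ℝ) < ((n' + 1 : ℤ) : ℝ) := by push_cast; linarith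
  have hlt' : x < n' + 1 := Int.cast_lt.mp hlt
  omega

/-- The same glue with D2 in p694174's literal `zpow` currency `(2:ℝ) ^ (-(n : ℤ)) ≤ ‖val‖`. -/
theorem lower_of_norm_sandwich_zpow {A B g n' x : ℤ} {r : ℝ}
    (hcont : (2 : ℝ) ^ (-(n' : ℤ)) ≤ r) (hval : r ≤ (2 : ℝ) ^ ((1 : ℝ) / 2 - (x : ℝ)))
    (halg : n' = B + g) (hx : x = A + g) : A ≤ B := by
  have e : (2 : ℝ) ^ (-(n' : ℤ)) = (2 : ℝ) ^ (-(n' : ℝ)) := by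
    rw [← Real.rpow_intCast]; push_cast; rfl
  exact lower_of_norm_sandwich (e ▸ hcont) hval halg hx

/-- The half-step is the most the sandwich tolerates. -/
theorem norm_sandwich_excludes_next {n' x : ℤ}
    (h : (2 : ℝ) ^ (-(n' : ℝ)) ≤ (2 : ℝ) ^ ((1 : ℝ) / 2 - (x : ℝ))) : x ≤ n' := by
  have h' : (-(n' : ℝ)) ≤ (1 : ℝ) / 2 - (x : ℝ) :=
    (Real.rpow_le_rpow_left_iff (by norm_num : (1 : ℝ) < 2)).mp h
  have hlt : ((x : ℤ) : ℝ) < ((n' + 1 : ℤ) : ℝ) := by push_cast; linarith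
  have hlt' : x < n' + 1 := Int.cast_lt.mp hlt
  omega

end Summit.BirchSwinnertonDyer.BirchSwinnertonDyer.Cruxes.SplitBadTwoLowerHalfOfFacts.StubIdeasK3G19
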